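import Literature.Topology.FourManifolds.HandleAttachingMapsExistence
import Literature.Topology.FourManifolds.PresentationHandlebodyFiveProofs
import Summits.SmoothPoincare4.SmoothPoincare4.Theorems.ConvexBisectionAcyclicBisectionExistsMultiAttachmentSplitData
import HarnessLib

/-!
# Splitting a simultaneous attachment of handles, II: `(M ∪ p) ∪ q = M ∪ (p, q)`
(helper file 2/3 of the NF6 brick for stub `stub_steinRealisation`, line `modp-braid-orbits` r11,
crux `ConvexBisection.AcyclicBisectionExists`, item stmt-SmoothPoincare4-10508; wave 1, lead c4)

Sequel of `…MultiAttachmentSplitData.lean` (the pieces `splitIncl`, `splitPtA`, `splitPtB`).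
Kosinski's re-association *"handles of the same index can all be attached at the same time"*
(Kosinski 1993, VI (7.1); VII, proof of (1.2)) for a finite family `q` of extra handles on top
of `X₁ = M ∪_{p} (handles)` (data `D₁`), attached along the lifted maps `j ↦ D₁.lift (q j)`
(`jA ∘ q̄ⱼ`, `MultiAttachmentData.lift`):

* `splitJA`, `splitJB`, `splitData` — given moreover data `D₂` of `X = X₁ ∪ (handles)` attached
  along the lifted family, the data exhibiting `X` as `M` with the family `Sum.elim p q`
  attached simultaneously: the `M`-piece `M ∖ (⋃ p̄ᵢ(S) ∪ ⋃ q̄ⱼ(S))` embedded by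
  `D₂.jA ∘ D₁.jA`, the old handles by `D₂.jA ∘ D₁.jB i`, the new ones by `D₂.jB j`;
* `isMultiAttachment_sumElim_of_lift`, `isMultiAttachment_lift_of_sumElim`,
  `isMultiAttachment_lift_iff_sumElim` — **`(M ∪ p) ∪ q = M ∪ (p, q)`** as an equivalence of the
  relational predicates (the converse by existence `exists_isMultiAttachment_holds`, uniqueness
  `IsMultiAttachment.nonempty_diffeomorph` and transport `IsMultiAttachment.of_diffeomorph`) —
  the family version of the tree's `MultiAttachmentData.isAttachment_lift_iff`;
* `isMultiAttachment_lift_iff_of_equiv` — the same for a family `h : ι → …` split along any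
  bijection `ι₁ ⊕ ι₂ ≃ ι` (re-indexing by the tree's `isMultiAttachment_comp_equiv_iff`);
* `exists_split_of_sumElim_eq`, `exists_split_castAdd_natAdd` / registered helper
  `helper_isMultiAttachment_split` — for `h : Fin (m + l) → HandleAttachingMap n k M` and
  `X = M ∪_{h} (handles)` there is a compact (if `M` is) Hausdorff second-countable
  `X₁ = M ∪ (h ∘ Fin.castAdd l)` with data `D₁` such that `X` is `X₁` with the suffix handles
  `D₁.lift (h (Fin.natAdd m j))` attached, i.e. `X = (M ∪ prefix handles) ∪ suffix handles`.

The case of a Lefschetz link over `Base g` realising a sorted word `P ++ N` is in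
`…MultiAttachmentSplitLink.lean`.  Everything here is proved; no named facts are introduced.

## References
* A. A. Kosinski, *Differential Manifolds*, Academic Press (1993), VI §6, (7.1), VII proof of
  (1.2). [Kosinski1993]
* R. İ. Baykur, *Kähler decomposition of 4-manifolds*, AGT 6 (2006), proof of Thm. 5.1.
  [Baykur2006]
-/

noncomputable section

-- the prescribed namespace `Summit.<P>.<Sub>.…` duplicates `SmoothPoincare4` (P = Sub)
set_option linter.dupNamespace false

open scoped Manifold ContDiff Topology

namespace Summit.SmoothPoincare4.SmoothPoincare4.Theorems.AcyclicBisectionExists.ModpBraidOrbits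

open Set Function
open Literature.Topology.FourManifolds Literature.Topology.FourManifolds.HandleAttachingMap

universe u

section Split

variable {n k : ℕ} {M : Type u} [TopologicalSpace M] [T2Space M]
  [ChartedSpace (EuclideanHalfSpace (n + 1)) M] [IsManifold (𝓡∂ (n + 1)) ∞ M]
  {ι₁ ι₂ : Type} [Finite ι₁] [Finite ι₂]
  {p : ι₁ → HandleAttachingMap n k M} {q : ι₂ → HandleAttachingMap n k M}
  {X₁ : Type*} [TopologicalSpace X₁] [T2Space X₁] [ChartedSpace (EuclideanHalfSpace (n + 1)) X₁]
  [IsManifold (𝓡∂ (n + 1)) ∞ X₁]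
  (D₁ : MultiAttachmentData p (𝓡∂ (n + 1)) X₁)
  (hqp : ∀ j i, Disjoint (range (q j).toFun) (range (p i).toFun))
  {X : Type*} [TopologicalSpace X] [ChartedSpace (EuclideanHalfSpace (n + 1)) X]
  (D₂ : MultiAttachmentData (fun j => D₁.lift (q j) (hqp j)) (𝓡∂ (n + 1)) X)

/-! ### The data of `M ∪ (p, q)` assembled from `X₁ = M ∪ p` and `X = X₁ ∪ (jA ∘ q)` -/

/-- **The embedding of the `M`-piece**: `D₂.jA ∘ D₁.jA` on `M ∖ (⋃ p̄ᵢ(S) ∪ ⋃ q̄ⱼ(S))`. [folklore] -/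
def splitJA : ↥(coresComplement (Sum.elim p q)) → X := D₂.jA ∘ splitPtA D₁ hqp

/-- `splitJA` on points. [folklore] -/
theorem splitJA_apply (a : ↥(coresComplement (Sum.elim p q))) :
    splitJA D₁ hqp D₂ a = D₂.jA (splitPtA D₁ hqp a) := rfl

/-- **The handle embeddings**: the prefix handles through `D₂.jA`, the suffix handles by `D₂.jB`.
[folklore] -/
def splitJB : ι₁ ⊕ ι₂ → ↥(beltPiece n k) → X
  | Sum.inl i => D₂.jA ∘ splitPtB D₁ hqp i
  | Sum.inr j => D₂.jB j

/-- `splitJB (inl i) = D₂.jA ∘ splitPtBᵢ`. [folklore] -/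
@[simp] theorem splitJB_inl (i : ι₁) : splitJB D₁ hqp D₂ (Sum.inl i) = D₂.jA ∘ splitPtB D₁ hqp i :=
  rfl

/-- `splitJB (inr j) = D₂.jB j`. [folklore] -/
@[simp] theorem splitJB_inr (j : ι₂) : splitJB D₁ hqp D₂ (Sum.inr j) = D₂.jB j := rfl

/-- `splitJA` is an immersion at every point. [folklore] -/
theorem isImmersionAt_splitJA [IsManifold (𝓡∂ (n + 1)) ∞ X]
    (a : ↥(coresComplement (Sum.elim p q))) :
    Manifold.IsImmersionAt (𝓡∂ (n + 1)) (𝓡∂ (n + 1)) ∞ (splitJA D₁ hqp D₂) a := by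
  obtain ⟨F, _, _, hF⟩ := D₁.hjA.isImmersion
  exact ((isImmersionAtOfComplement_splitPtA D₁ hqp hF a).openEmbedding_comp D₂.hjA
    D₂.hjAo).isImmersionAt

/-- `splitJA` is a smooth embedding. [folklore] -/
theorem isSmoothEmbedding_splitJA [IsManifold (𝓡∂ (n + 1)) ∞ X] :
    Manifold.IsSmoothEmbedding (𝓡∂ (n + 1)) (𝓡∂ (n + 1)) ∞ (splitJA D₁ hqp D₂) :=
  ⟨Manifold.isImmersion_of_isImmersionAt_of_finrank_eq rfl (isImmersionAt_splitJA D₁ hqp D₂),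
    D₂.hjA.isEmbedding.comp (isEmbedding_splitPtA D₁ hqp)⟩

/-- `splitJA` has open range. [folklore] -/
theorem isOpen_range_splitJA : IsOpen (range (splitJA D₁ hqp D₂)) := by
  rw [splitJA, range_comp]
  exact (Topology.IsOpenEmbedding.mk D₂.hjA.isEmbedding D₂.hjAo).isOpenMap _
    (isOpen_range_splitPtA D₁ hqp)

/-- `D₂.jA ∘ splitPtBᵢ` is an immersion at every point. [folklore] -/
theorem isImmersionAt_splitJB_inl [IsManifold (𝓡∂ (n + 1)) ∞ X] (i : ι₁) (b : ↥(beltPiece n k)) :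
    Manifold.IsImmersionAt (𝓡∂ (n + 1)) (𝓡∂ (n + 1)) ∞ (splitJB D₁ hqp D₂ (Sum.inl i)) b := by
  obtain ⟨F, _, _, hF⟩ := (D₁.hjB i).1.isImmersion
  exact ((isImmersionAtOfComplement_splitPtB D₁ hqp i hF b).openEmbedding_comp D₂.hjA
    D₂.hjAo).isImmersionAt

/-- The handle embeddings are smooth embeddings with open ranges. [folklore] -/
theorem isSmoothEmbedding_splitJB [IsManifold (𝓡∂ (n + 1)) ∞ X] (x : ι₁ ⊕ ι₂) :
    Manifold.IsSmoothEmbedding (𝓡∂ (n + 1)) (𝓡∂ (n + 1)) ∞ (splitJB D₁ hqp D₂ x) ∧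
      IsOpen (range (splitJB D₁ hqp D₂ x)) := by
  cases x with
  | inr j => exact D₂.hjB j
  | inl i =>
    refine ⟨⟨Manifold.isImmersion_of_isImmersionAt_of_finrank_eq rfl
      (isImmersionAt_splitJB_inl D₁ hqp D₂ i),
      D₂.hjA.isEmbedding.comp (isEmbedding_splitPtB D₁ hqp i)⟩, ?_⟩
    rw [splitJB_inl, range_comp]
    exact (Topology.IsOpenEmbedding.mk D₂.hjA.isEmbedding D₂.hjAo).isOpenMap _
      (isOpen_range_splitPtB D₁ hqp i)

/-- **The pieces cover `X`.** [folklore] -/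
theorem cover_split : range (splitJA D₁ hqp D₂) ∪ (⋃ x, range (splitJB D₁ hqp D₂ x)) = univ := by
  refine eq_univ_of_forall fun z => ?_
  rcases D₂.mem_range_or z with ⟨y, rfl⟩ | ⟨j, b, rfl⟩
  · -- `z = D₂.jA y`, `y ∈ X₁ ∖ ⋃ jA(q̄ⱼ(S))`: `y = D₁.jA a` with `a ∉ q̄ⱼ(S)`, or `y = D₁.jB i b`
    rcases D₁.mem_range_or (y : X₁) with ⟨a, ha⟩ | ⟨i, b, hb⟩
    · have haq : ∀ j, (a : M) ∉ (q j).core := fun j => by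
        rw [← D₁.jA_mem_core_lift_iff (q j) (hqp j), ha]
        exact (mem_coresComplement _).1 y.2 j
      refine Or.inl ⟨⟨a, mem_coresComplement_sumElim_iff.2 ⟨a.2, haq⟩⟩, ?_⟩
      rw [splitJA_apply]
      congr 1
      exact Subtype.ext ha
    · refine Or.inr (mem_iUnion.2 ⟨Sum.inl i, b, ?_⟩)
      rw [splitJB_inl, comp_apply]
      congr 1
      exact Subtype.ext hb
  · exact Or.inr (mem_iUnion.2 ⟨Sum.inr j, b, rfl⟩)

/-- **The gluing relations of the assembled presentation.** [folklore] -/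
theorem glue_split (x : ι₁ ⊕ ι₂) (a : ↥(coresComplement (Sum.elim p q))) (b : ↥(beltPiece n k)) :
    splitJA D₁ hqp D₂ a = splitJB D₁ hqp D₂ x b ↔
      (Sum.elim p q x).glueRel (a : M)
        (b : (Metric.closedBall (0 : EuclideanSpace ℝ (Fin (n + 1))) 1)) := by
  cases x with
  | inl i =>
    rw [splitJB_inl, splitJA_apply, comp_apply, D₂.injective_jA.eq_iff, Sum.elim_inl]
    exact ⟨fun e => (D₁.glue i (splitIncl p q a) b).1 (congrArg Subtype.val e),
      fun e => Subtype.ext ((D₁.glue i (splitIncl p q a) b).2 e)⟩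
  | inr j =>
    rw [splitJB_inr, splitJA_apply, D₂.glue j, Sum.elim_inr, coe_splitPtA]
    exact D₁.glueRel_lift_jA_iff (q j) (hqp j) _ _

/-- **The handles of the assembled presentation are pairwise disjoint.** [folklore] -/
theorem disjointB_split :
    Pairwise fun x y => Disjoint (range (splitJB D₁ hqp D₂ x)) (range (splitJB D₁ hqp D₂ y)) := by
  have key : ∀ i j, Disjoint (range (splitJB D₁ hqp D₂ (Sum.inl i)))
      (range (splitJB D₁ hqp D₂ (Sum.inr j))) := fun i j => by
    refine Set.disjoint_left.2 ?_
    rintro _ ⟨b, rfl⟩ ⟨b', he⟩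
    rw [splitJB_inl, splitJB_inr, comp_apply] at he
    exact D₁.not_glueRel_lift_jB (q j) (hqp j) i b
      (b' : (Metric.closedBall (0 : EuclideanSpace ℝ (Fin (n + 1))) 1)) ((D₂.glue j _ _).1 he.symm)
  rintro (i | j) (i' | j') hne
  · have hii : i ≠ i' := fun c => hne (congrArg Sum.inl c)
    refine Set.disjoint_left.2 ?_
    rintro _ ⟨b, rfl⟩ ⟨b', he⟩
    rw [splitJB_inl, splitJB_inl, comp_apply, comp_apply, D₂.injective_jA.eq_iff] at he
    have he' : D₁.jB i' b' = D₁.jB i b := congrArg Subtype.val he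
    exact Set.disjoint_left.1 (D₁.disjointB hii) (mem_range_self b) ⟨b', he'⟩
  · exact key i j'
  · exact (key i' j).symm
  · exact D₂.disjointB fun c => hne (congrArg Sum.inr c)

/-- **The data of `X = M ∪ (p, q)` assembled from `X₁ = M ∪ p` and `X = X₁ ∪ (jA ∘ q)`**
(Kosinski 1993, VI (7.1): handles of the same index *"can all be attached at the same time"*).
[cite: Kosinski1993, VI (7.1)] -/
def splitData [IsManifold (𝓡∂ (n + 1)) ∞ X] : MultiAttachmentData (Sum.elim p q) (𝓡∂ (n + 1)) X where
  disjoint := pairwise_disjoint_sumElim D₁.disjoint (pairwise_disjoint_of_lift D₁ hqp D₂.disjoint)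
    hqp
  jA := splitJA D₁ hqp D₂
  jB := splitJB D₁ hqp D₂
  hjA := isSmoothEmbedding_splitJA D₁ hqp D₂
  hjAo := isOpen_range_splitJA D₁ hqp D₂
  hjB := isSmoothEmbedding_splitJB D₁ hqp D₂
  cover := cover_split D₁ hqp D₂
  glue := glue_split D₁ hqp D₂
  disjointB := disjointB_split D₁ hqp D₂

/-! ### `(M ∪ p) ∪ q = M ∪ (p, q)` -/

/-- **Re-association, direct: `(M ∪ p) ∪ q` is `M ∪ (p, q)`.**  If `X₁` is `M` with the handles `p̄ᵢ`
attached (data `D₁`) and `X` is `X₁` with handles attached along the lifted maps `jA ∘ q̄ⱼ`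
(`MultiAttachmentData.lift`), then `X` is `M` with the whole family `(p̄ᵢ, q̄ⱼ)` attached
simultaneously (Kosinski 1993, VI (7.1); VII, proof of (1.2): handles of one index *"can all be
attached at the same time"*). [cite: Kosinski1993, VI (7.1)] -/
theorem isMultiAttachment_sumElim_of_lift [IsManifold (𝓡∂ (n + 1)) ∞ X]
    (hX : IsMultiAttachment (fun j => D₁.lift (q j) (hqp j)) (𝓡∂ (n + 1)) X) :
    IsMultiAttachment (Sum.elim p q) (𝓡∂ (n + 1)) X := by
  obtain ⟨D₂⟩ := hX.nonempty_multiAttachmentData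
  exact (splitData D₁ hqp D₂).isMultiAttachment

/-- **Re-association, converse: `M ∪ (p, q)` is `(M ∪ p) ∪ q`.**  If `X` is `M` with the family
`(p̄ᵢ, q̄ⱼ)` attached simultaneously and `X₁` is `M` with the `p̄ᵢ` attached (data `D₁`, `X₁` second
countable), then `X` is `X₁` with handles attached along the lifted `jA ∘ q̄ⱼ`: take some attachment
`X'` of the lifted family to `X₁` (`exists_isMultiAttachment_holds`); by the direct half it is
`M ∪ (p, q)`, hence diffeomorphic to `X` (`IsMultiAttachment.nonempty_diffeomorph`), and the
attachment is transported (`IsMultiAttachment.of_diffeomorph`). [cite: Kosinski1993, VI (7.1)] -/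
theorem isMultiAttachment_lift_of_sumElim [SecondCountableTopology X₁] [IsManifold (𝓡∂ (n + 1)) ∞ X]
    (hX : IsMultiAttachment (Sum.elim p q) (𝓡∂ (n + 1)) X) :
    IsMultiAttachment (fun j => D₁.lift (q j) (hqp j)) (𝓡∂ (n + 1)) X := by
  have hq : Pairwise fun j j' => Disjoint (range (q j).toFun) (range (q j').toFun) :=
    fun j j' hne => hX.1 fun c => hne (Sum.inr_injective c)
  obtain ⟨X', _, _, _, -, -, -, hX'⟩ := exists_isMultiAttachment_holds n k X₁ ι₂
    (fun j => D₁.lift (q j) (hqp j)) (pairwise_disjoint_lift D₁ hqp hq)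
  obtain ⟨e⟩ := (isMultiAttachment_sumElim_of_lift D₁ hqp hX').nonempty_diffeomorph hX
  exact hX'.of_diffeomorph e

/-- **`(M ∪ p) ∪ q = M ∪ (p, q)` as an equivalence of the relational predicates**: for data `D₁` of
`X₁ = M ∪ p` (second countable), a manifold `X` is `X₁` with handles attached along the lifted
`jA ∘ q̄ⱼ` iff it is `M` with `(p̄ᵢ, q̄ⱼ)` attached simultaneously — the family version of the tree's
`MultiAttachmentData.isAttachment_lift_iff` (one extra handle). [cite: Kosinski1993, VI (7.1)] -/
theorem isMultiAttachment_lift_iff_sumElim [SecondCountableTopology X₁] [IsManifold (𝓡∂ (n + 1)) ∞ X] :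
    IsMultiAttachment (fun j => D₁.lift (q j) (hqp j)) (𝓡∂ (n + 1)) X ↔
      IsMultiAttachment (Sum.elim p q) (𝓡∂ (n + 1)) X :=
  ⟨isMultiAttachment_sumElim_of_lift D₁ hqp, isMultiAttachment_lift_of_sumElim D₁ hqp⟩

end Split

/-! ### Splitting a family along a bijection `ι₁ ⊕ ι₂ ≃ ι`; prefix and suffix of `Fin (m + l)` -/

section Equiv

variable {n k : ℕ} {M : Type u} [TopologicalSpace M] [T2Space M]
  [ChartedSpace (EuclideanHalfSpace (n + 1)) M] [IsManifold (𝓡∂ (n + 1)) ∞ M]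
  {ι ι₁ ι₂ : Type} [Finite ι] [Finite ι₁] [Finite ι₂]
  {X : Type*} [TopologicalSpace X] [ChartedSpace (EuclideanHalfSpace (n + 1)) X]
  [IsManifold (𝓡∂ (n + 1)) ∞ X]

/-- **Splitting along a bijection of the index types.**  For a family `h̄ : ι → …` written as
`(p̄, q̄)` along `e : ι₁ ⊕ ι₂ ≃ ι` (`Sum.elim p q x = h (e x)`) and data `D₁` of `X₁ = M ∪ p`
(second countable): `X` is `X₁` with the lifted `jA ∘ q̄ⱼ` attached iff `X` is `M ∪_{h̄} (handles)`
(re-indexing `IsMultiAttachment (h ∘ e) ↔ IsMultiAttachment h`, the tree's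
`isMultiAttachment_comp_equiv_iff`, and `isMultiAttachment_lift_iff_sumElim`).
[cite: Kosinski1993, VI (7.1)] -/
theorem isMultiAttachment_lift_iff_of_equiv {X₁ : Type*} [TopologicalSpace X₁] [T2Space X₁]
    [SecondCountableTopology X₁] [ChartedSpace (EuclideanHalfSpace (n + 1)) X₁]
    [IsManifold (𝓡∂ (n + 1)) ∞ X₁] {p : ι₁ → HandleAttachingMap n k M}
    {q : ι₂ → HandleAttachingMap n k M} (h : ι → HandleAttachingMap n k M) (e : ι₁ ⊕ ι₂ ≃ ι)
    (he : ∀ x, Sum.elim p q x = h (e x)) (D₁ : MultiAttachmentData p (𝓡∂ (n + 1)) X₁)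
    (hqp : ∀ j i, Disjoint (range (q j).toFun) (range (p i).toFun)) :
    IsMultiAttachment (fun j => D₁.lift (q j) (hqp j)) (𝓡∂ (n + 1)) X ↔
      IsMultiAttachment h (𝓡∂ (n + 1)) X := by
  have hfam : Sum.elim p q = h ∘ e := funext he
  rw [← isMultiAttachment_comp_equiv_iff e, ← hfam]
  exact isMultiAttachment_lift_iff_sumElim D₁ hqp

omit [T2Space M] [IsManifold (𝓡∂ (n + 1)) ∞ M] [Finite ι] [Finite ι₁] [Finite ι₂] in
/-- Disjointness across the split, from that of the whole family. [folklore] -/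
theorem disjoint_of_sumElim_eq {p : ι₁ → HandleAttachingMap n k M} {q : ι₂ → HandleAttachingMap n k M}
    {h : ι → HandleAttachingMap n k M} (e : ι₁ ⊕ ι₂ ≃ ι) (he : ∀ x, Sum.elim p q x = h (e x))
    (hd : Pairwise fun x y => Disjoint (range (h x).toFun) (range (h y).toFun)) (j : ι₂) (i : ι₁) :
    Disjoint (range (q j).toFun) (range (p i).toFun) := by
  have hj : q j = h (e (Sum.inr j)) := he (Sum.inr j)
  have hi : p i = h (e (Sum.inl i)) := he (Sum.inl i)
  rw [hj, hi]
  exact hd fun c => Sum.inr_ne_inl (e.injective c)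

omit [T2Space M] [IsManifold (𝓡∂ (n + 1)) ∞ M] [Finite ι] [Finite ι₁] [Finite ι₂] in
/-- Disjointness of the prefix, from that of the whole family. [folklore] -/
theorem pairwise_disjoint_of_sumElim_eq {p : ι₁ → HandleAttachingMap n k M}
    {q : ι₂ → HandleAttachingMap n k M} {h : ι → HandleAttachingMap n k M} (e : ι₁ ⊕ ι₂ ≃ ι)
    (he : ∀ x, Sum.elim p q x = h (e x))
    (hd : Pairwise fun x y => Disjoint (range (h x).toFun) (range (h y).toFun)) :
    Pairwise fun i i' => Disjoint (range (p i).toFun) (range (p i').toFun) := by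
  intro i i' hne
  have hi : p i = h (e (Sum.inl i)) := he (Sum.inl i)
  have hi' : p i' = h (e (Sum.inl i')) := he (Sum.inl i')
  rw [hi, hi']
  exact hd fun c => hne (Sum.inl_injective (e.injective c))

/-- **Existence of the splitting `X = (M ∪ p) ∪ q`.**  If `X` is `M ∪_{h̄} (handles)` (`M` second
countable) and `h̄ = (p̄, q̄)` along `e : ι₁ ⊕ ι₂ ≃ ι`, there is a Hausdorff second-countable manifold
`X₁ = M ∪ p` (compact if `M` is; `exists_isMultiAttachment_holds`) with data `D₁` such that `X` is
`X₁` with the lifted `jA ∘ q̄ⱼ` attached. [cite: Kosinski1993, VI (7.1)] -/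
theorem exists_split_of_sumElim_eq [SecondCountableTopology M] {p : ι₁ → HandleAttachingMap n k M}
    {q : ι₂ → HandleAttachingMap n k M} (h : ι → HandleAttachingMap n k M) (e : ι₁ ⊕ ι₂ ≃ ι)
    (he : ∀ x, Sum.elim p q x = h (e x)) (hX : IsMultiAttachment h (𝓡∂ (n + 1)) X) :
    ∃ (X₁ : Type u) (_ : TopologicalSpace X₁) (_ : T2Space X₁) (_ : SecondCountableTopology X₁)
      (_ : ChartedSpace (EuclideanHalfSpace (n + 1)) X₁) (_ : IsManifold (𝓡∂ (n + 1)) ∞ X₁)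
      (D₁ : MultiAttachmentData p (𝓡∂ (n + 1)) X₁)
      (hqp : ∀ j i, Disjoint (range (q j).toFun) (range (p i).toFun)),
      (CompactSpace M → CompactSpace X₁) ∧
      IsMultiAttachment (fun j => D₁.lift (q j) (hqp j)) (𝓡∂ (n + 1)) X := by
  obtain ⟨X₁, _, _, _, hT2, hSC, hcpt, hX₁⟩ :=
    exists_isMultiAttachment_holds n k M ι₁ p (pairwise_disjoint_of_sumElim_eq e he hX.1)
  haveI := hT2
  haveI := hSC
  exact ⟨X₁, _, hT2, hSC, _, _, hX₁.multiAttachmentData, disjoint_of_sumElim_eq e he hX.1, hcpt,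
    (isMultiAttachment_lift_iff_of_equiv h e he hX₁.multiAttachmentData _).2 hX⟩

/-- `Fin (m + l)` split into its first `m` and last `l` indices: `Sum.elim (h ∘ castAdd l)
(h ∘ natAdd m) = h ∘ finSumFinEquiv`. [folklore] -/
theorem sumElim_castAdd_natAdd {α : Type*} {m l : ℕ} (h : Fin (m + l) → α) (x : Fin m ⊕ Fin l) :
    Sum.elim (fun i => h (Fin.castAdd l i)) (fun j => h (Fin.natAdd m j)) x = h (finSumFinEquiv x) := by
  cases x <;> simp

/-- **Prefix/suffix splitting of a simultaneous attachment, `X = (M ∪ h̄|_{castAdd}) ∪ h̄|_{natAdd}`.**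
For `h̄ : Fin (m + l) → …` and `X = M ∪_{h̄} (handles)` (`M` second countable) there is a Hausdorff
second-countable `X₁ = M ∪ (h̄ ∘ Fin.castAdd l)` (compact if `M` is) with data `D₁` such that `X` is
`X₁` with the suffix handles attached along the lifted `jA ∘ h̄ (Fin.natAdd m j)`, and conversely
every such attachment is `M ∪_{h̄} (handles)`. [cite: Kosinski1993, VI (7.1)] -/
theorem exists_split_castAdd_natAdd [SecondCountableTopology M] {m l : ℕ}
    (h : Fin (m + l) → HandleAttachingMap n k M) (hX : IsMultiAttachment h (𝓡∂ (n + 1)) X) :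
    ∃ (X₁ : Type u) (_ : TopologicalSpace X₁) (_ : T2Space X₁) (_ : SecondCountableTopology X₁)
      (_ : ChartedSpace (EuclideanHalfSpace (n + 1)) X₁) (_ : IsManifold (𝓡∂ (n + 1)) ∞ X₁)
      (D₁ : MultiAttachmentData (fun i : Fin m => h (Fin.castAdd l i)) (𝓡∂ (n + 1)) X₁)
      (hd : ∀ (j : Fin l) (i : Fin m),
        Disjoint (range (h (Fin.natAdd m j)).toFun) (range (h (Fin.castAdd l i)).toFun)),
      (CompactSpace M → CompactSpace X₁) ∧
      IsMultiAttachment (fun j : Fin l => D₁.lift (h (Fin.natAdd m j)) (hd j)) (𝓡∂ (n + 1)) X ∧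
      ∀ (X₂ : Type u) [TopologicalSpace X₂] [ChartedSpace (EuclideanHalfSpace (n + 1)) X₂]
        [IsManifold (𝓡∂ (n + 1)) ∞ X₂],
        IsMultiAttachment (fun j : Fin l => D₁.lift (h (Fin.natAdd m j)) (hd j)) (𝓡∂ (n + 1)) X₂ ↔
          IsMultiAttachment h (𝓡∂ (n + 1)) X₂ := by
  obtain ⟨X₁, _, _, _, _, _, D₁, hd, hcpt, hX'⟩ :=
    exists_split_of_sumElim_eq h finSumFinEquiv (sumElim_castAdd_natAdd h) hX
  exact ⟨X₁, _, inferInstance, inferInstance, _, _, D₁, hd, hcpt, hX', fun X₂ _ _ _ =>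
    isMultiAttachment_lift_iff_of_equiv h finSumFinEquiv (sumElim_castAdd_natAdd h) D₁ hd⟩

end Equiv

/-! ### The registered helpers -/

/-- **Registered helper `helper_isMultiAttachment_split` (sub-goal of NF6 `stub_steinRealisation`,
wave 1, lead c4): prefix/suffix splitting of a simultaneous attachment of handles.**  For
`h̄ : Fin (m + l) → HandleAttachingMap n k M` on a compact-or-not Hausdorff second-countable `M` and
`X = M ∪_{h̄} (handles)`: there is `X₁ = M ∪ (h̄ ∘ Fin.castAdd l)` (Hausdorff, second countable,
compact if `M` is) with multi-attachment data `D₁`, such that `X` is `X₁` with the suffix handles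
attached along the lifted maps `D₁.lift (h̄ (Fin.natAdd m j))`, and a manifold is such an attachment
iff it is `M ∪_{h̄} (handles)` (Kosinski 1993, VI (7.1): *"attached at the same time"*, and
conversely in two batches). [cite: Kosinski1993, VI (7.1)] -/
theorem helper_isMultiAttachment_split :
    ∀ (n k m l : ℕ) (M : Type) [TopologicalSpace M] [T2Space M] [SecondCountableTopology M]
      [ChartedSpace (EuclideanHalfSpace (n + 1)) M] [IsManifold (𝓡∂ (n + 1)) ∞ M]
      (h : Fin (m + l) → HandleAttachingMap n k M) (X : Type) [TopologicalSpace X]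
      [ChartedSpace (EuclideanHalfSpace (n + 1)) X] [IsManifold (𝓡∂ (n + 1)) ∞ X],
      HandleAttachingMap.IsMultiAttachment h (𝓡∂ (n + 1)) X →
      ∃ (X₁ : Type) (_ : TopologicalSpace X₁) (_ : T2Space X₁) (_ : SecondCountableTopology X₁)
        (_ : ChartedSpace (EuclideanHalfSpace (n + 1)) X₁) (_ : IsManifold (𝓡∂ (n + 1)) ∞ X₁)
        (D₁ : HandleAttachingMap.MultiAttachmentData (fun i : Fin m => h (Fin.castAdd l i))
          (𝓡∂ (n + 1)) X₁)
        (hd : ∀ (j : Fin l) (i : Fin m),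
          Disjoint (Set.range (h (Fin.natAdd m j)).toFun) (Set.range (h (Fin.castAdd l i)).toFun)),
        (CompactSpace M → CompactSpace X₁) ∧
        HandleAttachingMap.IsMultiAttachment
          (fun j : Fin l => D₁.lift (h (Fin.natAdd m j)) (hd j)) (𝓡∂ (n + 1)) X ∧
        ∀ (X₂ : Type) [TopologicalSpace X₂] [ChartedSpace (EuclideanHalfSpace (n + 1)) X₂]
          [IsManifold (𝓡∂ (n + 1)) ∞ X₂],
          HandleAttachingMap.IsMultiAttachment
              (fun j : Fin l => D₁.lift (h (Fin.natAdd m j)) (hd j)) (𝓡∂ (n + 1)) X₂ ↔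
            HandleAttachingMap.IsMultiAttachment h (𝓡∂ (n + 1)) X₂ :=
  fun _ _ _ _ _ _ _ _ _ _ h _ _ _ _ hX => exists_split_castAdd_natAdd h hX

end Summit.SmoothPoincare4.SmoothPoincare4.Theorems.AcyclicBisectionExists.ModpBraidOrbits

end
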